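/-
Copyright (c) 2026. All rights reserved.
Released under Apache 2.0 license as described in the file LICENSE.
Authors: abc-iut cell, statement-typer seat abc-iut-L4-t3 (wave 1).
-/
import Mathlib.Data.Real.Basic
import Mathlib.Topology.Algebra.ContinuousMonoidHom
import Literature.AnabelianGeometry.AbsoluteAnabelian.LogFrobeniusRigidity
import HarnessLib

/-!
# [AbsTopIII] Corollary 5.5 (vi) and Corollary 5.10 (iii): the panalocalization morphism `D⊚ → D✠` and the log-shells

S. Mochizuki, *Topics in absolute anabelian geometry III: global reconstruction algorithms*,
J. Math. Sci. Univ. Tokyo 22 (2015) 939–1156 [MochizukiAbsTopIII2015]; locators `p.N` = pages of the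
author's manuscript (`paper:url-5493eb38cbb7`; journal pagination not held), read on the page: Cor 5.5 (vi) p. 132
(proof p. 133: "immediate from the definitions"); Cor 5.10 preamble pp. 146–147 (`•`-shell-containers), (i), (iii) p. 147.

Continuation of `LogFrobeniusCorollaries.lean` (Cor 5.5 (i)–(iv), Cor 5.10 (iv)(a)–(c)) and `LogFrobeniusRigidity.lean`
(Cor 5.5 (v): nexus, total `□`-rigidity, the shifts `L.shiftOneMorphism k`). For two settings `L₁` (`• = ⊚`) and `L₂`
(`• = ✠`) of the same `Z`, `T` over the same `V(F_mod)`: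
* Cor 5.5 (vi): INTERFACE `Panalocalization L₁ L₂` = the DATA of "a natural panalocalization morphism of diagrams of
  categories `D⊚ → D✠` [cf. the panalocalization functors of Definition 5.1, (iv), (vi)] that lies over the evident
  isomorphism of oriented graphs": one functor per type of vertex (ONE functor `Th⊚_T[Z] → Th✠_T[Z]` at all `𝒳`-vertices,
  ONE functor `Th⊚[Z] → Th✠[Z]` at the `ℰ`-vertices, the former lying over the latter; equivalences on the mono-analytic
  rows, which do not depend on `•`, Cor 5.10 p. 146 — `D⊢` being carried separately by `L₁` and `L₂`) and one 2-cell per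
  type of arrow; the 1-morphism `D⊚⊢ → D✠⊢` (Def 3.5 (v), `DiagramMorphisms.lean`) is CONSTRUCTED from it
  (`Panalocalization.hom`); the assertion = `Cor55Panalocalization`: compatibility (Def 3.5 (v)) with families of
  homotopies realising the cores of (i) and the observables of (iii), with the generating datum `η_{An•}` of the contact
  structure of (ii) (the telecore edges `φ_{An•}` carry the 2-cell `isoφAn`), and with the `ℤ`-actions of (v);
* Cor 5.10 preamble and (iii): `•`-shell-containers are DEFINED (`ShellContainer`) and TRANSPORTED along a
  panalocalization (`Panalocalization.mapShellContainer`, from the 1-morphism data alone); "the log-volumes of (i), as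
  well as the construction of the `•`-log-shells from the various shell-homotopies, are compatible with the
  panalocalization morphism" = `Cor510Panalocalization` over the interface `ShellInvariants` (Cor 5.10 (i): "`S^Gal` …
  equipped with a well-defined log-volume … the `•`-log-shell is contained in `S^Gal`"; the numerical log-volumes are
  those of `LogShellVolumes.lean` / `LocalVolumes*.lean` — TODO-merge at instantiation).

Every `Prop` below is an ASSUMPTION on the interface data (`P`, the invariants) which the text asserts for the genuine
Galois-theaters. NOT here: the extension of the panalocalization to the telecore DIAGRAM `D_{An•}` of Cor 5.5 (ii) with
its families `𝔍`, `ℋ_{An•}` (typed at the level of the generating data only — TODO(general form)). Refereed pre-IUT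
material; nothing here bears on [IUTchIII] Cor. 3.12; typed ≠ discharged.
-/

set_option autoImplicit false

universe u

open CategoryTheory Quiver

namespace Literature.AnabelianGeometry.AbsoluteAnabelian

variable {Vmod : Type u} {isArc : Vmod → Bool}

/-! ## Corollary 5.5 (vi): the panalocalization morphism `D⊚ → D✠` -/

/-- INTERFACE (Cor 5.5 (vi)). For the settings `L₁` (`• = ⊚`) and `L₂` (`• = ✠`) of one `Z`, `T`: the DATA of "a natural
panalocalization morphism of diagrams of categories `D⊚ → D✠` [cf. the panalocalization functors of Definition 5.1,
(iv), (vi)] that lies over the evident isomorphism of oriented graphs `Γ⃗_{D⊚} ⥲ Γ⃗_{D✠}`" — Def 3.5 (v): one functor per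
TYPE of vertex (the panalocalization functor `Th⊚_T[Z] → Th✠_T[Z]` of Def 5.1 (vi) at every `𝒳_⋎` and at `□`; the
panalocalization functor `Th⊚[Z] → Th✠[Z]` of Def 5.1 (iv) at `ℰ•`, the former lying over the latter; the induced functors
at `𝒩⊞_v`, `𝒩_v`, `An•[𝒳]`; equivalences at the rows of `D⊢`, which do not depend on `•` (Cor 5.10 p. 146) but are carried
separately by `L₁`, `L₂`) and one isomorphism of functors per TYPE of arrow (Def 3.5 (v)(c)), together with the 2-cell at
the telecore functor `φ_{An•}`. The 1-morphism `D⊚⊢ → D✠⊢` itself is CONSTRUCTED from these data (`Panalocalization.hom`),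
so that its vertex functors are the named functors by `rfl`. [cite: MochizukiAbsTopIII2015, Cor 5.5 (vi) p. 132] -/
structure Panalocalization (L₁ L₂ : LogFrobeniusSetting Vmod isArc) : Type (u + 2) where
  /-- the panalocalization functor `Th⊚_T[Z] → Th✠_T[Z]` (Def 5.1 (vi)), at the vertices `𝒳_⋎` and `□` -/
  panT : L₁.X ⥤ L₂.X
  /-- the panalocalization functor `Th⊚[Z] → Th✠[Z]` (Def 5.1 (iv)), at the vertices `ℰ•` -/
  pan : L₁.E ⥤ L₂.E
  /-- "`Th⊚_T → Th✠_T` — lying over the functor `Th⊚ → Th✠`" (Def 5.1 (vi)) -/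
  over : panT ⋙ L₂.proj ≅ L₁.proj ⋙ pan
  /-- the induced functor at `𝒩⊞_v` -/
  panNplus : ∀ v : Vmod, L₁.Nplus v ⥤ L₂.Nplus v
  /-- the induced functor at `𝒩_v` -/
  panN : ∀ v : Vmod, L₁.N v ⥤ L₂.N v
  /-- the induced functor at `An•[𝒳]` -/
  panAn : L₁.An ⥤ L₂.An
  /-- at `𝒩⊢⊞_w` (mono-analytic: an equivalence) -/
  panNmonoPlus : ∀ w : Vmod, L₁.NmonoPlus w ⥤ L₂.NmonoPlus w
  /-- at `𝒩⊢_w` -/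
  panNmono : ∀ w : Vmod, L₁.Nmono w ⥤ L₂.Nmono w
  /-- at `ℰ⊢` -/
  panEmono : L₁.Emono ⥤ L₂.Emono
  /-- at `An⊢[𝒩⊢⊞]` -/
  panAnMono : L₁.AnMono ⥤ L₂.AnMono
  /-- the 2-cell at the arrows `log` (one for all `⋎`) -/
  isoLog : panT ⋙ L₂.log ≅ L₁.log ⋙ panT
  /-- the 2-cell at the arrows `λ⊞_{v,ν} : □ → 𝒩⊞_v` -/
  isoLam : ∀ (v : Vmod) (ν : LogVertex (isArc v)), panT ⋙ L₂.lam v ν ≅ L₁.lam v ν ⋙ panNplus v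
  /-- the 2-cell at `𝒩⊞_v → 𝒩_v` -/
  isoForget : ∀ v : Vmod, panNplus v ⋙ L₂.forget v ≅ L₁.forget v ⋙ panN v
  /-- the 2-cell at `𝒩_v → ℰ•` -/
  isoToE : ∀ v : Vmod, panN v ⋙ L₂.toE v ≅ L₁.toE v ⋙ pan
  /-- the 2-cell at `κ_{An•} : ℰ• → An•[𝒳]` -/
  isoκAn : pan ⋙ L₂.κAn.functor ≅ L₁.κAn.functor ⋙ panAn
  /-- the 2-cell at `An•[𝒳] → ℰ•` (row 6 → 7) -/
  isoAnToE : panAn ⋙ L₂.κAn₂.functor ≅ L₁.κAn₂.functor ⋙ pan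
  /-- the 2-cell at the mono-analyticization arrows `𝒩⊞_v → 𝒩⊢⊞_v` -/
  isoMonoNplus : ∀ v : Vmod, panNplus v ⋙ L₂.monoNplus v ≅ L₁.monoNplus v ⋙ panNmonoPlus v
  /-- the 2-cell at `𝒩_v → 𝒩⊢_v` -/
  isoMonoN : ∀ v : Vmod, panN v ⋙ L₂.monoN v ≅ L₁.monoN v ⋙ panNmono v
  /-- the 2-cell at `ℰ• → ℰ⊢` (rows 5 and 7) -/
  isoMonoE : pan ⋙ L₂.monoAn ≅ L₁.monoAn ⋙ panEmono
  /-- the 2-cell at `An•[𝒳] → An⊢[𝒩⊢⊞]` -/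
  isoMonoAn : panAn ⋙ (L₂.κAn.inverse ⋙ L₂.monoAn ⋙ L₂.κAnMono.functor) ≅
    (L₁.κAn.inverse ⋙ L₁.monoAn ⋙ L₁.κAnMono.functor) ⋙ panAnMono
  /-- the 2-cell at `𝒩⊢⊞_w → 𝒩⊢_w` -/
  isoForgetMono : ∀ w : Vmod, panNmonoPlus w ⋙ L₂.forgetMono w ≅ L₁.forgetMono w ⋙ panNmono w
  /-- the 2-cell at `𝒩⊢_w → ℰ⊢` -/
  isoToEmono : ∀ w : Vmod, panNmono w ⋙ L₂.toEmono w ≅ L₁.toEmono w ⋙ panEmono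
  /-- the 2-cell at `ℰ⊢ → An⊢[𝒩⊢⊞]` -/
  isoκAnMono : panEmono ⋙ L₂.κAnMono.functor ≅ L₁.κAnMono.functor ⋙ panAnMono
  /-- the 2-cell at `An⊢[𝒩⊢⊞] → ℰ⊢` -/
  isoAnMonoToE : panAnMono ⋙ L₂.κAnMono.inverse ≅ L₁.κAnMono.inverse ⋙ panEmono
  /-- the 2-cell at the telecore functor `φ_{An•} : An•[𝒳] → 𝒳` (Cor 5.5 (ii)) -/
  isoφAn : panAn ⋙ L₂.φAn ≅ L₁.φAn ⋙ panT
  /-- on the rows of `D⊢` the functors are equivalences -/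
  panNmonoPlus_isEquivalence : ∀ w, (panNmonoPlus w).IsEquivalence
  /-- idem -/
  panNmono_isEquivalence : ∀ w, (panNmono w).IsEquivalence
  /-- idem -/
  panEmono_isEquivalence : panEmono.IsEquivalence
  /-- idem -/
  panAnMono_isEquivalence : panAnMono.IsEquivalence

namespace Panalocalization

variable {L₁ L₂ : LogFrobeniusSetting Vmod isArc} (P : Panalocalization L₁ L₂)

/-- the functor of the panalocalization at a vertex of `D•⊢`. [cite: MochizukiAbsTopIII2015, Cor 5.5 (vi) p. 132] -/
def app : (x : DVertex Vmod isArc) → (x.category L₁ ⥤ x.category L₂)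
  | .row1 _ => P.panT
  | .core => P.panT
  | .nplus v => P.panNplus v
  | .nv v => P.panN v
  | .e5 => P.pan
  | .an => P.panAn
  | .e7 => P.pan
  | .nmonoPlus w => P.panNmonoPlus w
  | .nmono w => P.panNmono w
  | .emono5 => P.panEmono
  | .anMono => P.panAnMono
  | .emono7 => P.panEmono

/-- the 2-cell of the panalocalization at an arrow of `D•⊢` (Def 3.5 (v)(c); at `id_⋎ : 𝒳_⋎ → □` it is the identity).
[cite: MochizukiAbsTopIII2015, Cor 5.5 (vi) p. 132] -/
def iso : {a b : DVertex Vmod isArc} → (e : a ⟶ b) → (P.app a ⋙ DEdge.functor L₂ e ≅ DEdge.functor L₁ e ⋙ P.app b)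
  | _, _, .log _ => P.isoLog
  | _, _, .toCore _ => P.panT.rightUnitor ≪≫ P.panT.leftUnitor.symm
  | _, _, .lam v ν _ => P.isoLam v ν
  | _, _, .forget v => P.isoForget v
  | _, _, .toE v => P.isoToE v
  | _, _, .κAn => P.isoκAn
  | _, _, .anToE => P.isoAnToE
  | _, _, .monoNplus v => P.isoMonoNplus v
  | _, _, .monoN v => P.isoMonoN v
  | _, _, .monoE5 => P.isoMonoE
  | _, _, .monoAn => P.isoMonoAn
  | _, _, .monoE7 => P.isoMonoE
  | _, _, .forgetMono w => P.isoForgetMono w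
  | _, _, .toEmono w => P.isoToEmono w
  | _, _, .κAnMono => P.isoκAnMono
  | _, _, .anMonoToE => P.isoAnMonoToE

/-- the panalocalization morphism `D⊚⊢ → D✠⊢` as a 1-morphism of diagrams of categories (Def 3.5 (v)) over the identity
of the common shape. [cite: MochizukiAbsTopIII2015, Cor 5.5 (vi) p. 132] -/
def hom : DiagramOfCategories.OneMorphism (𝟭q (DVertex Vmod isArc)) L₁.diagram L₂.diagram where
  app := P.app
  iso e := P.iso e

/-- "compatible with the cores of (i) [and] the observables of (iii)": Def 3.5 (v)-compatibility of the 1-morphism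
with families of homotopies on `D⊚⊢`, `D✠⊢` realising them — TYPED FOR THE `⊞`-HALF: `RealisesCor55Families`
(`LogFrobeniusCorollaries.lean`) carries the cores of (i) and the observables `S_log⊞` only; the `TS`-valued observables
`S_log` of (iii) (`LogFrobeniusObservables.lean`, `TSHomotopies`) are not conjoined here (audit note L6-t22 N2;
TODO(general form): a `TSHomotopies`-indexed conjunct). [cite: MochizukiAbsTopIII2015, Cor 5.5 (vi) p. 132] -/
def CompatibleWithFamilies : Prop :=
  ∃ (K₁ : L₁.diagram.HomotopyFamily) (K₂ : L₂.diagram.HomotopyFamily),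
    L₁.RealisesCor55Families K₁ ∧ L₂.RealisesCor55Families K₂ ∧ Nonempty (P.hom.CompatibleWith K₁ K₂)

/-- the comparison 2-cell `π_{An⊚} ⋙ φ_{An⊚} ⋙ (panalocalization) ≅ (panalocalization) ⋙ π_{An✠} ⋙ φ_{An✠}` built from
`over`, `isoκAn` and `isoφAn`. [cite: MochizukiAbsTopIII2015, Cor 5.5 (vi) p. 132] -/
noncomputable def telecoreComparison :
    ((L₁.proj ⋙ L₁.κAn.functor) ⋙ L₁.φAn) ⋙ P.panT ≅ P.panT ⋙ ((L₂.proj ⋙ L₂.κAn.functor) ⋙ L₂.φAn) :=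
  Functor.associator _ _ _ ≪≫ Functor.isoWhiskerLeft _ P.isoφAn.symm ≪≫ (Functor.associator _ _ _).symm ≪≫
    Functor.isoWhiskerRight
      (Functor.associator _ _ _ ≪≫ Functor.isoWhiskerLeft L₁.proj P.isoκAn.symm ≪≫
        (Functor.associator _ _ _).symm ≪≫ Functor.isoWhiskerRight P.over.symm _ ≪≫ Functor.associator _ _ _)
      L₂.φAn ≪≫
    Functor.associator _ _ _

/-- "compatible with the telecore and contact structures of (ii)", at the level of their generating data (Cor 5.5
(ii): the telecore edges are copies of `φ_{An•}` — handled by the 2-cell `isoφAn` — and the contact structure is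
generated by `η_{An•}`): under the comparison 2-cell, `η_{An⊚}` is carried to `η_{An✠}`.
[cite: MochizukiAbsTopIII2015, Cor 5.5 (vi) p. 132] -/
def CompatibleWithTelecoreData : Prop :=
  Functor.whiskerRight L₁.ηAn.hom P.panT ≫ P.panT.leftUnitor.hom =
    P.telecoreComparison.hom ≫ Functor.whiskerLeft P.panT L₂.ηAn.hom ≫ P.panT.rightUnitor.hom

/-- "compatible with the `ℤ`-actions of (v)": the panalocalization intertwines the shifts of `D⊚⊢` and `D✠⊢` up to
2-isomorphism. [cite: MochizukiAbsTopIII2015, Cor 5.5 (vi) p. 132] -/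
def CompatibleWithShifts : Prop :=
  ∀ k : ℤ, DiagramOfCategories.OneMorphism.Isomorphic (F := DVertex.shiftGraph k)
    ((L₁.shiftOneMorphism k).comp P.hom) (P.hom.comp (L₂.shiftOneMorphism k))

/-- **Cor 5.5 (vi)** (assumption on `P`): the panalocalization morphism "is compatible with the cores of (i), the
telecore and contact structures of (ii), the observables of (iii), and the `ℤ`-actions of (v)".
[cite: MochizukiAbsTopIII2015, Cor 5.5 (vi) p. 132] -/
def Cor55Panalocalization : Prop :=
  P.CompatibleWithFamilies ∧ P.CompatibleWithTelecoreData ∧ P.CompatibleWithShifts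

end Panalocalization

/-! ## Corollary 5.10, preamble and (iii): `•`-shell-containers and panalocalization -/

/-- the vertex `ν` of `Γ⃗^×_v` at which shell-container structures are taken: "the terminal (respectively, initial)
vertex of the shell-arrow of `Γ⃗^×_v`" for `v` nonarchimedean (respectively, archimedean).
[cite: MochizukiAbsTopIII2015, Cor 5.10 p. 146] -/
def LogVertex.shellVertex : (b : Bool) → LogVertex b
  | true => ArchVertex.shellInitial
  | false => NonarchVertex.shellTerminal

/-- the shell vertex is a pre-log vertex. [cite: MochizukiAbsTopIII2015, Cor 5.10 p. 146] -/
theorem LogVertex.shellVertex_isPostLog (b : Bool) : (LogVertex.shellVertex b).isPostLog = false := by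
  cases b <;> rfl

/-- **Cor 5.10, preamble**: a `•`-SHELL-CONTAINER at `v` — an object `S ∈ Ob(𝒩⊞_v)` with "the datum of an object
`S' ∈ Ob(𝒳)` together with an isomorphism `S ⥲ λ⊞_{v,ν}(S')`, where `ν` is the terminal (respectively, initial) vertex of
the shell-arrow of `Γ⃗^×_v`". [cite: MochizukiAbsTopIII2015, Cor 5.10 pp. 146–147] -/
structure ShellContainer (L : LogFrobeniusSetting Vmod isArc) (v : Vmod) : Type (u + 1) where
  /-- the object `S` of `𝒩⊞_v` -/
  obj : L.Nplus v
  /-- the object `S'` of `𝒳 = Th•_T[Z]` -/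
  src : L.X
  /-- the `•`-shell-container structure `S ⥲ λ⊞_{v,ν}(S')` -/
  iso : obj ≅ (L.lam v (LogVertex.shellVertex (isArc v))).obj src

/-- TRANSPORT of `•`-shell-containers along a panalocalization (constructed from the 1-morphism data alone):
`S ↦ Φ_{𝒩⊞_v}(S)` with the structure `Φ(S) ≅ Φ(λ⊞_{v,ν} S') ≅ λ⊞_{v,ν}(Φ_□ S')` given by the 2-cell of the panalocalization
at the arrow `λ⊞_{v,ν} : □ → 𝒩⊞_v`. [cite: MochizukiAbsTopIII2015, Cor 5.10 (iii) p. 147] -/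
noncomputable def Panalocalization.mapShellContainer {L₁ L₂ : LogFrobeniusSetting Vmod isArc}
    (P : Panalocalization L₁ L₂) {v : Vmod} (C : ShellContainer L₁ v) : ShellContainer L₂ v where
  obj := (P.panNplus v).obj C.obj
  src := P.panT.obj C.src
  iso := (P.panNplus v).mapIso C.iso ≪≫ (P.isoLam v (LogVertex.shellVertex (isArc v))).symm.app C.src

/-- the data Cor 5.10 (i) attaches to a shell-container `S`: "`S^Gal`, the topological submodule of Galois-invariants of
(respectively, the topological submodule constituted by) the underlying object of `TS⊞` (respectively, `TH⊞` …)
determined by `S`", "equipped with a well-defined log-volume (respectively, well-defined radial and angular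
log-volumes)", in which "the `•`-log-shell is contained". At a nonarchimedean `v` the two log-volume fields coincide by
convention. [cite: MochizukiAbsTopIII2015, Cor 5.10 (i) p. 147] -/
structure GalModuleData : Type (u + 1) where
  /-- `S^Gal` -/
  carrier : Type u
  /-- its topology -/
  [top : TopologicalSpace carrier]
  /-- its additive structure -/
  [grp : AddCommGroup carrier]
  /-- the (radial) log-volume on subsets of `S^Gal` -/
  logVol : Set carrier → ℝ
  /-- the angular log-volume (archimedean `v`) -/
  angLogVol : Set carrier → ℝ
  /-- the `•`-log-shell `ℐ ⊆ S^Gal` determined by the shell-homotopy -/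
  shell : Set carrier

attribute [instance] GalModuleData.top GalModuleData.grp

/-- identification of two such data: an isomorphism of topological modules carrying log-volumes to log-volumes and
log-shell to log-shell. [cite: MochizukiAbsTopIII2015, Cor 5.10 (iii) p. 147] -/
structure GalModuleData.Iso (A B : GalModuleData.{u}) : Type u where
  /-- the isomorphism of topological modules `A^Gal ≅ B^Gal` -/
  equiv : A.carrier ≃ₜ+ B.carrier
  /-- … carrying the (radial) log-volume of `A` to that of `B` -/
  logVol_image : ∀ s : Set A.carrier, B.logVol (equiv '' s) = A.logVol s
  /-- … and the angular log-volume -/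
  angLogVol_image : ∀ s : Set A.carrier, B.angLogVol (equiv '' s) = A.angLogVol s
  /-- … and the log-shell onto the log-shell -/
  shell_image : equiv '' A.shell = B.shell

/-- INTERFACE (Cor 5.10 (i)): the assignment to every `•`-shell-container `S` at every `v` of `S^Gal` with its
log-volume(s) and `•`-log-shell ("that depend(s) only on the `•`-shell-container structure of `S`"). The numerical
log-volumes are those of Prop 5.7 / Def 5.9 (ii) (`LocalVolumes*.lean`, `LogShellVolumes.lean`); this is the bridge
from the abstract categories `𝒩⊞_v` to them — TODO-merge at instantiation. [cite: MochizukiAbsTopIII2015, Cor 5.10 (i) p. 147] -/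
def ShellInvariants (L : LogFrobeniusSetting Vmod isArc) : Type (u + 1) :=
  ∀ v : Vmod, ShellContainer L v → GalModuleData.{u}

/-- **Cor 5.10 (iii)** (Panalocalization; assumption on `P`, `I₁`, `I₂`): "the log-volumes of (i), as well as the
construction of the `•`-log-shells from the various shell-homotopies, are compatible with the panalocalization morphism
`D⊚ → D✠` of Corollary 5.5, (vi)" — for every `⊚`-shell-container `S` at `v`, `S^Gal` and `Φ(S)^Gal` are identified
compatibly with their log-volumes and with their log-shells. [cite: MochizukiAbsTopIII2015, Cor 5.10 (iii) p. 147] -/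
def Cor510Panalocalization {L₁ L₂ : LogFrobeniusSetting Vmod isArc} (P : Panalocalization L₁ L₂)
    (I₁ : ShellInvariants L₁) (I₂ : ShellInvariants L₂) : Prop :=
  ∀ (v : Vmod) (C : ShellContainer L₁ v), Nonempty (GalModuleData.Iso (I₁ v C) (I₂ v (P.mapShellContainer C)))

end Literature.AnabelianGeometry.AbsoluteAnabelian
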